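import Mathlib.FieldTheory.Finite.Basic
import Mathlib.Analysis.SpecialFunctions.Pow.Real
import HarnessLib

/-!
# Route `SymplecticPurity`, item `CubeGraphFlat` (stmt-QuantumAdvantage-9836) — field-side helpers

Elementary facts about a finite field `K` with `2 ^ n` elements behind the almost-bent witness
`x ↦ x³` (Gold 1968; Nyberg, EUROCRYPT '93; Carlet, *Boolean Functions for Cryptography and Coding
Theory* (2021), ch. 11), written for ADDITIVE functionals `K →+ ZMod 2` (every `𝔽₂`-linear
identification `K ≃ 𝔽₂ⁿ` turns the coordinate masks of a Pauli `Z`-string into such functionals):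

* `two_eq_zero_of_card` — `2 = 0` in `K`;
* `sum_sign_eq_zero` — a non-zero additive character sums to `0` over `K`;
* `card_filter_cube_diff_le_two` — `x ↦ x³` is almost perfect nonlinear: `(u + α)³ + u³ = β` has at
  most two solutions when `(α, β) ≠ (0, 0)` (a quadratic in `u`);
* `sq_walsh_cube_le` / `abs_walsh_cube_le` — near-bentness: for additive `φ ψ : K →+ ZMod 2` with
  `ψ ≠ 0`, `|Σ_u (−1)^{φ u + ψ (u³)}| ≤ 2 √|K|`. Proof: square and substitute `v = u + t`; the inner
  sum is the character sum of the ADDITIVE map `u ↦ ψ (t u² + t² u)`, hence `|K|` or `0`; the set of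
  `t` where it is `|K|` consists of `0` and elements with one common cube (if `t₁, t₂ ≠ 0` are both
  in it, take `c` with `t₁ c² = t₂` — squares exist in characteristic two — and compare), so it has
  at most `1 + 3 = 4` elements.

No trace form is used: the functional `ψ` itself plays the role of `Tr(β ·)`.
-/

set_option linter.dupNamespace false -- D-0017: single-problem summit ⇒ `QuantumAdvantage.QuantumAdvantage` by design

namespace Summit.QuantumAdvantage.QuantumAdvantage.Theorems.SymplecticPurity

open Finset Polynomial

variable {K : Type*} [Field K] [Fintype K]

/-- The two elements of `ZMod 2`. -/
theorem zmod_two_eq_zero_or_eq_one (z : ZMod 2) : z = 0 ∨ z = 1 := by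
  revert z; decide

/-- In `ZMod 2`, `a + b = 0 ↔ a = b`. -/
theorem zmod_two_add_eq_zero_iff (a b : ZMod 2) : a + b = 0 ↔ a = b := by
  revert a b; decide

/-- Multiplicativity of the real sign character of `ZMod 2`: `(−1)^x (−1)^y = (−1)^{x+y}`. -/
theorem sign_mul_sign (x y : ZMod 2) :
    (if x = 0 then (1 : ℝ) else -1) * (if y = 0 then (1 : ℝ) else -1) =
      if x + y = 0 then (1 : ℝ) else -1 := by
  have h10 : (1 : ZMod 2) ≠ 0 := by decide
  have h11 : (1 : ZMod 2) + 1 = 0 := by decide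
  rcases zmod_two_eq_zero_or_eq_one x with rfl | rfl <;>
    rcases zmod_two_eq_zero_or_eq_one y with rfl | rfl <;> simp [h10, h11]

/-- The sign character of a finite sum is the product of the sign characters. -/
theorem prod_sign_eq {ι : Type*} (s : Finset ι) (z : ι → ZMod 2) :
    ∏ i ∈ s, (if z i = 0 then (1 : ℝ) else -1) = if ∑ i ∈ s, z i = 0 then (1 : ℝ) else -1 := by
  classical
  induction s using Finset.induction_on with
  | empty => simp
  | insert a s ha ih => rw [Finset.prod_insert ha, Finset.sum_insert ha, ih, sign_mul_sign]

/-- A finite field with `2 ^ n` elements has characteristic two: `2 = 0` (and `n ≠ 0`). -/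
theorem two_eq_zero_of_card {n : ℕ} (hK : Fintype.card K = 2 ^ n) : (2 : K) = 0 := by
  have hn : n ≠ 0 := by
    rintro rfl
    have h1 := Fintype.one_lt_card (α := K)
    rw [hK, pow_zero] at h1
    exact lt_irrefl _ h1
  have h := FiniteField.cast_card_eq_zero K
  rw [hK, Nat.cast_pow, Nat.cast_ofNat] at h
  exact (pow_eq_zero_iff hn).1 h

/-- A finite field with `2 ^ n` elements has `ringChar K = 2`. -/
theorem ringChar_eq_two_of_card {n : ℕ} (hK : Fintype.card K = 2 ^ n) : ringChar K = 2 :=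
  CharP.ringChar_of_prime_eq_zero Nat.prime_two (by exact_mod_cast two_eq_zero_of_card hK)

/-- A non-zero additive functional `L : K →+ ZMod 2` is balanced: `Σ_u (−1)^{L u} = 0`. -/
theorem sum_sign_eq_zero {G : Type*} [AddCommGroup G] [Fintype G] (L : G →+ ZMod 2) (hL : L ≠ 0) :
    ∑ u : G, (if L u = 0 then (1 : ℝ) else -1) = 0 := by
  obtain ⟨u₀, hu₀⟩ : ∃ u₀, L u₀ ≠ 0 := by
    by_contra h
    push Not at h
    exact hL (AddMonoidHom.ext h)
  have h1 : L u₀ = 1 := (zmod_two_eq_zero_or_eq_one _).resolve_left hu₀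
  have h10 : (1 : ZMod 2) ≠ 0 := by decide
  have h11 : (1 : ZMod 2) + 1 = 0 := by decide
  have hS : ∑ u : G, (if L u = 0 then (1 : ℝ) else -1) =
      ∑ u : G, (if L (u + u₀) = 0 then (1 : ℝ) else -1) :=
    (Equiv.sum_comp (Equiv.addRight u₀) (fun u => if L u = 0 then (1 : ℝ) else -1)).symm
  have hneg : ∀ u : G, (if L (u + u₀) = 0 then (1 : ℝ) else -1) = -(if L u = 0 then (1 : ℝ) else -1) := by
    intro u
    rw [map_add, h1]
    rcases zmod_two_eq_zero_or_eq_one (L u) with h | h <;> simp [h, h10, h11]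
  simp_rw [hneg, Finset.sum_neg_distrib] at hS
  linarith

omit [Fintype K] in
/-- For a non-zero additive functional `ψ` on a field, `u ↦ ψ (γ u)` vanishes identically only for
`γ = 0` (the pairing `(γ, u) ↦ ψ (γ u)` is non-degenerate). -/
theorem eq_zero_of_forall_apply_mul_eq_zero (ψ : K →+ ZMod 2) (hψ : ψ ≠ 0) (γ : K)
    (h : ∀ u : K, ψ (γ * u) = 0) : γ = 0 := by
  by_contra hγ
  apply hψ
  ext y
  have hy := h (γ⁻¹ * y)
  rwa [← mul_assoc, mul_inv_cancel₀ hγ, one_mul] at hy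

/-- **`x ↦ x³` is APN** (Nyberg 1993; Carlet 2021, ch. 11): in characteristic two the equation
`(u + α)³ + u³ = β`, i.e. `α u² + α² u + α³ = β`, has at most two solutions `u` whenever
`(α, β) ≠ (0, 0)` (for `α = 0 ≠ β` it has none). -/
theorem card_filter_cube_diff_le_two [DecidableEq K] (h2 : (2 : K) = 0) (α β : K)
    (hαβ : α ≠ 0 ∨ β ≠ 0) :
    (Finset.univ.filter fun u : K => (u + α) ^ 3 + u ^ 3 = β).card ≤ 2 := by
  rcases eq_or_ne α 0 with rfl | hα
  · have hβ : β ≠ 0 := hαβ.resolve_left (fun h => h rfl)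
    have he : (Finset.univ.filter fun u : K => (u + 0) ^ 3 + u ^ 3 = β) = ∅ := by
      refine Finset.filter_eq_empty_iff.mpr ?_
      intro u _ hu
      apply hβ
      rw [← hu]
      linear_combination (u ^ 3) * h2
    rw [he, Finset.card_empty]
    exact Nat.zero_le _
  · set p : K[X] := C α * X ^ 2 + C (α ^ 2) * X + C (α ^ 3 - β) with hp_def
    have hp : p ≠ 0 := by
      intro h0
      have hc := congrArg (fun q : K[X] => q.coeff 2) h0
      simp only [hp_def, coeff_add, coeff_C_mul, coeff_X_pow, coeff_X, coeff_C, coeff_zero] at hc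
      norm_num at hc
      exact hα hc
    calc (Finset.univ.filter fun u : K => (u + α) ^ 3 + u ^ 3 = β).card
        ≤ p.roots.toFinset.card := by
          refine Finset.card_le_card fun u hu => ?_
          rw [Finset.mem_filter] at hu
          rw [Multiset.mem_toFinset, Polynomial.mem_roots hp, Polynomial.IsRoot.def]
          simp only [hp_def, eval_add, eval_mul, eval_C, eval_pow, eval_X]
          linear_combination hu.2 - (u ^ 3 + α * u ^ 2 + α ^ 2 * u) * h2
      _ ≤ Multiset.card p.roots := Multiset.toFinset_card_le _
      _ ≤ p.natDegree := Polynomial.card_roots' p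
      _ ≤ 2 := Polynomial.natDegree_quadratic_le

/-- Key step of the near-bent bound: if `t₁, t₂ ≠ 0` both make the additive map
`u ↦ ψ (t u² + t² u)` vanish identically (`ψ ≠ 0` additive), then `t₁³ = t₂³`.  (Take `c` with
`t₁ c² = t₂`; then `ψ (t₂ u²) = ψ (t₁² c u)` and `= ψ (t₂² u)`, so `t₁² c = t₂²`; square and compare.) -/
theorem cube_eq_cube_of_kernel (h2 : (2 : K) = 0) (hchar : ringChar K = 2) (ψ : K →+ ZMod 2)
    (hψ : ψ ≠ 0) {t₁ t₂ : K} (ht₁ : t₁ ≠ 0) (ht₂ : t₂ ≠ 0)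
    (h₁ : ∀ u : K, ψ (t₁ * u ^ 2 + t₁ ^ 2 * u) = 0)
    (h₂ : ∀ u : K, ψ (t₂ * u ^ 2 + t₂ ^ 2 * u) = 0) : t₁ ^ 3 = t₂ ^ 3 := by
  obtain ⟨c, hc⟩ := FiniteField.isSquare_of_char_two hchar (t₂ / t₁)
  have hE1 : t₁ * c ^ 2 = t₂ := by
    rw [sq, ← hc]
    field_simp
  have h₁' : ∀ u : K, ψ (t₁ * u ^ 2) = ψ (t₁ ^ 2 * u) := fun u =>
    (zmod_two_add_eq_zero_iff _ _).1 (by rw [← map_add]; exact h₁ u)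
  have h₂' : ∀ u : K, ψ (t₂ * u ^ 2) = ψ (t₂ ^ 2 * u) := fun u =>
    (zmod_two_add_eq_zero_iff _ _).1 (by rw [← map_add]; exact h₂ u)
  have hγ : t₁ ^ 2 * c + t₂ ^ 2 = 0 := by
    refine eq_zero_of_forall_apply_mul_eq_zero ψ hψ _ fun u => ?_
    rw [add_mul, map_add, zmod_two_add_eq_zero_iff]
    have hu := h₁' (c * u)
    rw [show t₁ * (c * u) ^ 2 = t₂ * u ^ 2 by rw [← hE1]; ring] at hu
    rw [show t₁ ^ 2 * c * u = t₁ ^ 2 * (c * u) by ring, ← hu, h₂' u]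
  have hE2 : t₁ ^ 2 * c = t₂ ^ 2 := by linear_combination hγ - (t₂ ^ 2) * h2
  have h3 : (t₁ ^ 3 - t₂ ^ 3) * t₂ = 0 := by
    linear_combination (t₁ ^ 2 * c + t₂ ^ 2) * hE2 - t₁ ^ 3 * hE1
  rcases mul_eq_zero.1 h3 with h | h
  · exact sub_eq_zero.1 h
  · exact absurd h ht₂

/-- The set of `t` for which `u ↦ ψ (t u² + t² u)` vanishes identically has at most four elements:
`0` and at most three non-zero elements sharing one cube. -/
theorem card_filter_kernel_le_four (h2 : (2 : K) = 0) (hchar : ringChar K = 2) (ψ : K →+ ZMod 2)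
    (hψ : ψ ≠ 0) :
    (Finset.univ.filter fun t : K => ∀ u : K, ψ (t * u ^ 2 + t ^ 2 * u) = 0).card ≤ 4 := by
  classical
  set T := Finset.univ.filter fun t : K => ∀ u : K, ψ (t * u ^ 2 + t ^ 2 * u) = 0 with hT_def
  by_cases hT : ∃ t₀ ∈ T, t₀ ≠ 0
  · obtain ⟨t₀, ht₀T, ht₀⟩ := hT
    have hsub : T.erase 0 ⊆ (Polynomial.nthRoots 3 (t₀ ^ 3)).toFinset := by
      intro t ht
      rw [Finset.mem_erase] at ht
      rw [Multiset.mem_toFinset, Polynomial.mem_nthRoots (by norm_num : 0 < 3)]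
      exact cube_eq_cube_of_kernel h2 hchar ψ hψ ht.1 ht₀ (Finset.mem_filter.1 ht.2).2
        (Finset.mem_filter.1 ht₀T).2
    have h0 : (0 : K) ∈ T := by
      rw [hT_def, Finset.mem_filter]
      exact ⟨Finset.mem_univ _, fun u => by simp⟩
    calc T.card = (T.erase 0).card + 1 := (Finset.card_erase_add_one h0).symm
      _ ≤ (Polynomial.nthRoots 3 (t₀ ^ 3)).toFinset.card + 1 := by
          gcongr
      _ ≤ Multiset.card (Polynomial.nthRoots 3 (t₀ ^ 3)) + 1 := by
          gcongr
          exact Multiset.toFinset_card_le _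
      _ ≤ 3 + 1 := by
          gcongr
          exact Polynomial.card_nthRoots 3 _
  · push Not at hT
    calc T.card ≤ ({0} : Finset K).card :=
          Finset.card_le_card fun t ht => Finset.mem_singleton.2 (hT t ht)
      _ ≤ 4 := by rw [Finset.card_singleton]; norm_num

/-- **Near-bentness of `x ↦ x³`, squared form** (Gold 1968; Carlet 2021, ch. 11): for additive
`φ ψ : K →+ ZMod 2` with `ψ ≠ 0`, `(Σ_u (−1)^{φ u + ψ (u³)})² ≤ 4 |K|`. -/
theorem sq_walsh_cube_le (h2 : (2 : K) = 0) (hchar : ringChar K = 2) (φ ψ : K →+ ZMod 2)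
    (hψ : ψ ≠ 0) :
    (∑ u : K, (if φ u + ψ (u ^ 3) = 0 then (1 : ℝ) else -1)) ^ 2 ≤ 4 * Fintype.card K := by
  classical
  have hsq : ∀ u v : K, (u + v) ^ 2 = u ^ 2 + v ^ 2 := fun u v => by
    linear_combination (u * v) * h2
  -- the inner additive functional `u ↦ ψ (t u² + t² u)`
  let L : K → K →+ ZMod 2 := fun t =>
    AddMonoidHom.mk' (fun u => ψ (t * u ^ 2 + t ^ 2 * u)) fun u v => by
      rw [← map_add, hsq]
      congr 1
      ring
  have hL : ∀ t u, L t u = ψ (t * u ^ 2 + t ^ 2 * u) := fun t u => rfl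
  -- Step 1: the square as a double sum, `v = u + t`
  have key : (∑ u : K, (if φ u + ψ (u ^ 3) = 0 then (1 : ℝ) else -1)) ^ 2 =
      ∑ t : K, (if φ t + ψ (t ^ 3) = 0 then (1 : ℝ) else -1) *
        ∑ u : K, (if L t u = 0 then (1 : ℝ) else -1) := by
    rw [sq, Finset.sum_mul_sum]
    have hre : ∀ u : K, ∑ v : K, (if φ u + ψ (u ^ 3) = 0 then (1 : ℝ) else -1) *
        (if φ v + ψ (v ^ 3) = 0 then (1 : ℝ) else -1) =
        ∑ t : K, (if φ u + ψ (u ^ 3) = 0 then (1 : ℝ) else -1) *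
          (if φ (u + t) + ψ ((u + t) ^ 3) = 0 then (1 : ℝ) else -1) := fun u =>
      (Equiv.sum_comp (Equiv.addLeft u) _).symm
    simp_rw [hre]
    rw [Finset.sum_comm]
    refine Finset.sum_congr rfl fun t _ => ?_
    rw [Finset.mul_sum]
    refine Finset.sum_congr rfl fun u _ => ?_
    rw [sign_mul_sign, sign_mul_sign, hL]
    have hcube : (u + t) ^ 3 = u ^ 3 + (t * u ^ 2 + t ^ 2 * u) + t ^ 3 := by
      linear_combination (u ^ 2 * t + u * t ^ 2) * h2
    rw [hcube, map_add, map_add, map_add]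
    have hzz : ∀ x y z w v : ZMod 2, x + y + (x + z + (y + w + v)) = z + v + w := by decide
    rw [hzz]
  -- Step 2: the inner sums are `|K|` or `0`
  have hI : ∀ t : K, ∑ u : K, (if L t u = 0 then (1 : ℝ) else -1) =
      if L t = 0 then (Fintype.card K : ℝ) else 0 := by
    intro t
    split_ifs with h
    · simp [h]
    · exact sum_sign_eq_zero (L t) h
  rw [key]
  simp_rw [hI]
  calc ∑ t : K, (if φ t + ψ (t ^ 3) = 0 then (1 : ℝ) else -1) *
        (if L t = 0 then (Fintype.card K : ℝ) else 0)
      ≤ ∑ t : K, (if L t = 0 then (Fintype.card K : ℝ) else 0) := by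
        refine Finset.sum_le_sum fun t _ => mul_le_of_le_one_left ?_ ?_
        · split_ifs <;> simp
        · split_ifs <;> norm_num
    _ = ((Finset.univ.filter fun t : K => L t = 0).card : ℝ) * Fintype.card K := by
        rw [← Finset.sum_filter, Finset.sum_const, nsmul_eq_mul]
    _ ≤ 4 * Fintype.card K := by
        gcongr
        have hTT : (Finset.univ.filter fun t : K => L t = 0) =
            Finset.univ.filter fun t : K => ∀ u : K, ψ (t * u ^ 2 + t ^ 2 * u) = 0 := by
          refine Finset.filter_congr fun t _ => ?_
          rw [AddMonoidHom.ext_iff]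
          rfl
        rw [hTT]
        exact_mod_cast card_filter_kernel_le_four h2 hchar ψ hψ

/-- **Near-bentness of `x ↦ x³`** (Gold 1968; Nyberg 1993; Carlet 2021, ch. 11): in a field with
`2 ^ n` elements, for additive `φ ψ : K →+ ZMod 2` with `ψ ≠ 0`,
`|Σ_u (−1)^{φ u + ψ (u³)}| ≤ 2 · √2 ^ n`. -/
theorem abs_walsh_cube_le {n : ℕ} (hK : Fintype.card K = 2 ^ n) (φ ψ : K →+ ZMod 2) (hψ : ψ ≠ 0) :
    |∑ u : K, (if φ u + ψ (u ^ 3) = 0 then (1 : ℝ) else -1)| ≤ 2 * Real.sqrt 2 ^ n := by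
  have h := sq_walsh_cube_le (two_eq_zero_of_card hK) (ringChar_eq_two_of_card hK) φ ψ hψ
  rw [hK] at h
  push_cast at h
  have hb : (2 * Real.sqrt 2 ^ n) ^ 2 = 4 * (2 : ℝ) ^ n := by
    rw [mul_pow, ← pow_mul, mul_comm n 2, pow_mul, Real.sq_sqrt (by norm_num : (0 : ℝ) ≤ 2)]
    norm_num
  have h' : (∑ u : K, (if φ u + ψ (u ^ 3) = 0 then (1 : ℝ) else -1)) ^ 2 ≤ (2 * Real.sqrt 2 ^ n) ^ 2 := by
    rw [hb]; exact h
  exact abs_le.2 (abs_le_of_sq_le_sq' h' (by positivity))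

end Summit.QuantumAdvantage.QuantumAdvantage.Theorems.SymplecticPurity
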